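import Literature.AlgebraicGeometry.HodgeTheory.UnitaryReflectionLieCore
import Literature.AlgebraicGeometry.HodgeTheory.GlZariskiClosureMatrixBridge
import Literature.NumberTheory.Automorphic.LieAlgebraGLDimension
import Literature.NumberTheory.Automorphic.LieAlgebraGLFiniteIndex
import Literature.NumberTheory.Automorphic.LieAlgebraGLNilpotentExp
import Literature.NumberTheory.Automorphic.LieAlgebraGLBracket
import Literature.NumberTheory.Automorphic.ZariskiGLDimension
import Literature.LinearAlgebra.Matrix.ProjectiveSpecialLinearGroupSimple
import HarnessLib

/-!
# An INFINITE unitary reflection group along one orbit of roots has `SL(W)` in the identity component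
# of its Zariski closure (Carlson–Toledo 1999 §7, Theorem `udensitytheo` — algebraic proof, part 4: from
# the Lie core to the group)

Family `hodge`, layer `Literature/AlgebraicGeometry/HodgeTheory`. THEOREMS only (no definition, no named
fact). Sequel of `UnitaryReflectionLieCore` (the Lie core `mem_of_trace_eq_zero`: for a reflection system,
a non-zero `Ad(Γ)`-stable bracket-closed space of traceless endomorphisms is `𝔰𝔩(W)`), combined with the
algebraic-group dictionary of `Literature/NumberTheory/Automorphic` on `K`-points (Zariski closure
`zariskiClosure`, identity component, Lie algebra `lieAlgebraGL`, `dim Lie(H) = dim H°`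
(`IsAlgebraicSubgroup.finrank_lieAlgebraGL_eq`), `Lie` of a finite-index subgroup
(`lieAlgebraGL_eq_of_finiteIndex`), nilpotents exponentiate into the group
(`expHom_mem_of_mem_lieAlgebraGL`)) and the matrix bridge `GlZariskiClosureMatrixBridge` to the
basis-free closures `glZariskiClosure` / `glIdentityComponent` of `AlgebraicMonodromyMumfordTate`.

* `trace_eq_zero_of_mem_lieAlgebraGL_of_det_pow_eq_one` — if `det(g)^N = 1` on `G ≤ GL_n` (`N ≠ 0`,
  characteristic `0`) then `Lie(G) ⊆ 𝔰𝔩ₙ` (`d(det⁻¹)^N = -N·tr`).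
* `lieAlgebraGL_ne_bot_of_infinite` — an infinite `G ≤ GL_n(k)` (`k` perfect) has `Lie(G) ≠ 0`
  (`(Ḡ)°` is infinite, `≠ 1`, so `dim (Ḡ)° ≥ 1`, and `dim Lie(Ḡ) = dim (Ḡ)°`).
* **`mem_glIdentityComponent_of_det_eq_one_of_infinite`** — for a reflection system (`B` non-degenerate
  sesquilinear on the finite-dimensional complex `W`, `dim W ≥ 2`, roots `δ ∈ Δ` with `B δ δ = ε`,
  `ε = ±1`, spanning, `Γ` the subgroup generated by the `λ`-reflections, transitive on `Δ`, `λ` a root of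
  unity `≠ ±1`) with `Γ` INFINITE, every determinant-one automorphism of `W` lies in
  `glIdentityComponent Γ`: `Lie(Γ) = Lie(Γ')` for every finite-index `Γ'`, it is `Ad(Γ)`-stable, non-zero
  and traceless, hence `= 𝔰𝔩(W)` by the Lie core; the elementary transvections are exponentials of
  nilpotents of `𝔰𝔩`, hence lie in `(Γ')^Zar`, and they generate `SL` (`SLn.transvection_induction`).
  This is the conclusion of `carlsonToledo1999_unitaryReflection_zariskiDense.mem_glIdentityComponent_of_det_eq_one`
  (`UnitaryCommutatorsIdentityComponent`) WITHOUT the named fact — the form consumed by the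
  Goursat–Kolchin–Ribet step of crux K1 of `Summits/HodgeConjecture/HodgeConjecture/Theses/CyclicUnitaryPowers.lean`.

Written by the prover seat `hodge-nonav-prover-Bx` (cell `hodge-nonav`, `stmt-HodgeConjecture-19544`).

## References
* [CarlsonToledo1999] J. A. Carlson, D. Toledo, *Discriminant complements and kernels of monodromy
  representations*, Duke Math. J. 97 (1999) 621–648, §7 Theorem `udensitytheo`.
* [SpringerLAG1998] T. A. Springer, *Linear Algebraic Groups*, 2nd ed. (1998), 2.2.1, 4.4.5–4.4.7,
  4.4.10 (3).
* [Artin1988] E. Artin, *Geometric Algebra*, Chap. IV Thm 4.6 (`SL_n` is generated by transvections).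
-/

noncomputable section

open Module
open scoped MatrixGroups

namespace Literature.AlgebraicGeometry.HodgeTheory

/-! ### §1 Two facts in the matrix vocabulary: `Lie(G) ⊆ 𝔰𝔩` when `det^N = 1`, and `Lie(G) ≠ 0` for
infinite `G` -/

section Matrix

open Literature.NumberTheory.Automorphic

variable {k : Type*} [Field k] {n : Type*} [Fintype n] [DecidableEq n]

/-- `d((det⁻¹)^m)_1 (A) = -m·tr A`: the differential at `1` of the `m`-th power of the coordinate
`det⁻¹` of `GL_n`. [cite: SpringerLAG1998, 4.4.10 (3)] -/
theorem tangentDeriv_X_inr_pow (A : Matrix n n k) (m : ℕ) :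
    tangentDeriv (MvPolynomial.X (Sum.inr ()) ^ m : MvPolynomial (GLCoord n) k) A =
      -((m : k) * Matrix.trace A) := by
  induction m with
  | zero => rw [pow_zero, ← MvPolynomial.C_1, tangentDeriv_C]; simp
  | succ m ih =>
    rw [pow_succ, tangentDeriv_mul_X, ih, MvPolynomial.eval_pow, MvPolynomial.eval_X, glCoordFun_inr,
      Units.val_one, Matrix.det_one, inv_one, one_pow, one_mul, mul_one]
    simp only [tangentCoord, Sum.elim_inr, Nat.cast_succ]
    ring

/-- **`Lie(G) ⊆ 𝔰𝔩ₙ` when `det^N = 1` on `G`** (`N ≠ 0`, characteristic `0`): the relation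
`(det⁻¹)^N - 1 ∈ 𝓘(G)` has differential `-N·tr` at `1`. [cite: SpringerLAG1998, 4.4.7 and 4.4.10 (3)] -/
theorem trace_eq_zero_of_mem_lieAlgebraGL_of_det_pow_eq_one [CharZero k] {G : Subgroup (GL n k)}
    {N : ℕ} (hN : N ≠ 0) (hG : ∀ g ∈ G, Matrix.det (g : Matrix n n k) ^ N = 1) {A : Matrix n n k}
    (hA : A ∈ lieAlgebraGL G) : Matrix.trace A = 0 := by
  rw [mem_lieAlgebraGL_iff] at hA
  have hp : (MvPolynomial.X (Sum.inr ()) ^ N - 1 : MvPolynomial (GLCoord n) k) ∈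
      MvPolynomial.vanishingIdeal k (glCoordFun '' (G : Set (GL n k))) := by
    rw [MvPolynomial.mem_vanishingIdeal_iff]
    rintro _ ⟨g, hg, rfl⟩
    simp only [map_sub, map_pow, MvPolynomial.aeval_X, glCoordFun_inr, map_one, inv_pow, hG g hg, inv_one,
      sub_self]
  have h := hA _ hp
  rw [tangentDeriv_sub, ← MvPolynomial.C_1, tangentDeriv_C, sub_zero, tangentDeriv_X_inr_pow,
    neg_eq_zero, mul_eq_zero] at h
  exact h.resolve_left (Nat.cast_ne_zero.2 hN)

/-- **An infinite subgroup of `GL_n(k)` (`k` perfect) has non-zero Lie algebra**: the identity component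
of its Zariski closure has finite index in an infinite group, so is infinite, hence `≠ 1`, hence of positive
dimension, and `dim Lie(Ḡ) = dim (Ḡ)°`. [cite: SpringerLAG1998, 2.2.1 (i) and 4.4.5–4.4.6] -/
theorem lieAlgebraGL_ne_bot_of_infinite [PerfectField k] {G : Subgroup (GL n k)}
    (hG : (G : Set (GL n k)).Infinite) : lieAlgebraGL G ≠ ⊥ := by
  classical
  set H := zariskiClosure G with hH
  have hHalg : IsAlgebraicSubgroup H := isAlgebraicSubgroup_zariskiClosure G
  set H0 := identityComponent H with hH0
  have hH0c : IsZConnected H0 := isZConnected_identityComponent hHalg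
  -- `H0` is infinite
  have hHinf : (H : Set (GL n k)).Infinite := hG.mono (SetLike.coe_subset_coe.2 (le_zariskiClosure G))
  have hH0inf : (H0 : Set (GL n k)).Infinite := by
    intro hfin
    apply hHinf
    haveI : Finite H0 := hfin.to_subtype
    haveI hfi : ((H0.subgroupOf H)).FiniteIndex := finiteIndex_identityComponent hHalg
    have hcard := Subgroup.card_mul_index (H0.subgroupOf H)
    have h1 : Nat.card (H0.subgroupOf H) = Nat.card H0 :=
      Nat.card_congr (Subgroup.subgroupOfEquivOfLe (identityComponent_le H)).toEquiv
    have h2 : Nat.card H0 ≠ 0 := Nat.card_pos.ne'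
    have h3 : Nat.card H ≠ 0 := by
      rw [← hcard, h1]; exact mul_ne_zero h2 hfi.index_ne_zero
    exact (Nat.finite_of_card_ne_zero h3 : Finite H)
  -- hence `⊥ < H0` and `dim H0 > 0`
  have hne : H0 ≠ ⊥ := by
    intro h
    apply hH0inf
    rw [h]
    exact Set.finite_singleton (1 : GL n k) |>.subset (by simp [Subgroup.coe_bot])
  have hlt : (⊥ : Subgroup (GL n k)) < H0 := bot_lt_iff_ne_bot.2 hne
  have hdim : 0 < hH0c.zdim := lt_of_le_of_lt (Nat.zero_le _) (isZConnected_bot.zdim_lt_of_lt hH0c hlt)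
  -- `dim Lie(G) = dim Lie(H) = dim H0`
  obtain ⟨hfin, hrk⟩ := IsAlgebraicSubgroup.finrank_lieAlgebraGL_eq hHalg
  have hrk' : Module.finrank k (lieAlgebraGL H) = hH0c.zdim := hrk
  rw [← lieAlgebraGL_zariskiClosure G]
  intro hbot
  rw [hbot, finrank_bot] at hrk'
  omega

/-- The exponential of the nilpotent `a·E_{ij}` (`i ≠ j`) at time `1` is the transvection `1 + a·E_{ij}`.
[cite: SpringerLAG1998, 4.4.10 (3)] -/
theorem coe_expHom_single [CharZero k] {i j : n} (hij : i ≠ j) (a : k)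
    (hnil : IsNilpotent (Matrix.single i j a)) :
    ((expHom (Matrix.single i j a) hnil (Multiplicative.ofAdd (1 : k)) : GL n k) : Matrix n n k) =
      Matrix.transvection i j a := by
  have h2 : Matrix.single i j a ^ 2 = 0 := by
    rw [pow_two]; exact Matrix.single_mul_single_of_ne a i j i (Ne.symm hij) a
  rw [coe_expHom_apply, toAdd_ofAdd, exp_smul_matrix_eq_sum h2]
  simp [Finset.sum_range_succ, Matrix.transvection]

end Matrix

/-! ### §2 `SL(W) ⊆ (Γ^Zar)°(ℂ)` for an infinite unitary reflection group -/

section Reflection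

open Literature.NumberTheory.Automorphic in
/-- Transport of `Ad`-stability, brackets and traces through a basis: for `Γ ≤ GL(W)` with matrix group
`Γm = Ψ Γ` (`Ψ g = [g]_b`), the subspace `{Y : [Y]_b ∈ Lie(Γm)}` of `End(W)` is closed under brackets and
under `Y ↦ γ Y γ⁻¹`, `γ ∈ Γ`. [cite: SpringerLAG1998, 4.4.5 (ii) and 4.4.7] -/
theorem comap_lieAlgebraGL_bracket_and_conj {W : Type*} [AddCommGroup W] [Module ℂ W] {ι : Type*}
    [Fintype ι] [DecidableEq ι] (b : Basis ι ℂ W) (Ψ : (W ≃ₗ[ℂ] W) ≃* GL ι ℂ)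
    (hΨ : ∀ g : W ≃ₗ[ℂ] W, ((Ψ g : GL ι ℂ) : Matrix ι ι ℂ) = LinearMap.toMatrix b b (g : W →ₗ[ℂ] W))
    (Γ : Subgroup (W ≃ₗ[ℂ] W)) :
    let L : Submodule ℂ (Module.End ℂ W) :=
      (lieAlgebraGL (Γ.map Ψ.toMonoidHom)).comap (LinearMap.toMatrix b b).toLinearMap
    (∀ Y ∈ L, ∀ Z ∈ L, Y * Z - Z * Y ∈ L) ∧
      ∀ g ∈ Γ, ∀ Y ∈ L, (g : Module.End ℂ W) * Y * ((g⁻¹ : W ≃ₗ[ℂ] W) : Module.End ℂ W) ∈ L := by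
  intro L
  refine ⟨fun Y hY Z hZ => ?_, fun g hg Y hY => ?_⟩
  · change LinearMap.toMatrix b b (Y * Z - Z * Y) ∈ lieAlgebraGL (Γ.map Ψ.toMonoidHom)
    rw [map_sub, LinearMap.toMatrix_mul, LinearMap.toMatrix_mul]
    exact lie_mem_lieAlgebraGL hY hZ
  · change LinearMap.toMatrix b b ((g : Module.End ℂ W) * Y * ((g⁻¹ : W ≃ₗ[ℂ] W) : Module.End ℂ W)) ∈
      lieAlgebraGL (Γ.map Ψ.toMonoidHom)
    rw [LinearMap.toMatrix_mul, LinearMap.toMatrix_mul, ← hΨ g, ← hΨ g⁻¹, map_inv]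
    exact conj_mem_lieAlgebraGL (Subgroup.mem_map_of_mem _ hg) hY

/-- Under the hypotheses of Theorem `udensitytheo`, every `γ ∈ Γ` satisfies `det(γ)^N = 1` where
`λ^N = 1` (each generating reflection satisfies `s_δ^N = 1`). [cite: CarlsonToledo1999, §7 Theorem udensitytheo] -/
theorem det_pow_eq_one_of_mem {W : Type*} [AddCommGroup W] [Module ℂ W] (B : W →ₗ⋆[ℂ] W →ₗ[ℂ] ℂ)
    {ε : ℂ} (hε : ε * ε = 1) {l : ℂ} {N : ℕ} (hlN : l ^ N = 1) {Δ : Set W} (hΔ : ∀ δ ∈ Δ, B δ δ = ε)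
    {Γ : Subgroup (W ≃ₗ[ℂ] W)}
    (hΓ : Γ = Subgroup.closure {g : W ≃ₗ[ℂ] W | ∃ δ ∈ Δ, (g : W →ₗ[ℂ] W) = complexReflection B ε l δ})
    {γ : W ≃ₗ[ℂ] W} (hγ : γ ∈ Γ) : LinearEquiv.det γ ^ N = 1 := by
  rw [hΓ] at hγ
  induction hγ using Subgroup.closure_induction with
  | mem g hg =>
    obtain ⟨δ, hδ, hgδ⟩ := hg
    rw [← map_pow, pow_eq_one_of_coe_eq_complexReflection B hε hlN (hΔ δ hδ) hgδ, map_one]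
  | one => rw [map_one, one_pow]
  | mul g h _ _ hg hh => rw [map_mul, mul_pow, hg, hh, one_mul]
  | inv g _ hg => rw [map_inv, inv_pow, hg, inv_one]

open Literature.NumberTheory.Automorphic in
/-- **`SL(W) ⊆ (Γ^Zar)°(ℂ)` for an INFINITE unitary reflection group along one orbit of roots**
(Carlson–Toledo's Theorem `udensitytheo` in the complex-points form consumed by the Goursat–Kolchin–Ribet
step): `B` non-degenerate sesquilinear on the finite-dimensional complex `W`, `dim W ≥ 2`, `ε = ±1`, `λ`
a root of unity `≠ ±1`, `Δ` a set of roots `B δ δ = ε` spanning `W`, `Γ` the subgroup generated by the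
`λ`-reflections along `Δ`, transitive on `Δ`; if `Γ` is infinite, every determinant-one automorphism of `W`
lies in `glIdentityComponent Γ`. Proof: for a finite-index `Γ' ≤ Γ`, `Lie(Γ') = Lie(Γ)` (matrix picture)
is `Ad(Γ)`-stable, bracket-closed, traceless (`det^N = 1`) and non-zero (`Γ` infinite), so equals `𝔰𝔩` by
the Lie core; elementary transvections are exponentials of nilpotents of `𝔰𝔩`, hence lie in `(Γ')^Zar`,
and generate `SL`. [cite: CarlsonToledo1999, §7 Theorem udensitytheo] -/
theorem mem_glIdentityComponent_of_det_eq_one_of_infinite {W : Type*} [AddCommGroup W] [Module ℂ W]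
    [FiniteDimensional ℂ W] {B : W →ₗ⋆[ℂ] W →ₗ[ℂ] ℂ} (hBn : B.Nondegenerate) (hW : 2 ≤ finrank ℂ W)
    {ε : ℂ} (hε : ε = 1 ∨ ε = -1) {l : ℂ} (hlN : ∃ N : ℕ, 0 < N ∧ l ^ N = 1) (hl1 : l ≠ 1)
    (hl2 : l ≠ -1) {Δ : Set W} (hΔ : ∀ δ ∈ Δ, B δ δ = ε) (hspan : Submodule.span ℂ Δ = ⊤)
    {Γ : Subgroup (W ≃ₗ[ℂ] W)}
    (hΓ : Γ = Subgroup.closure {g : W ≃ₗ[ℂ] W | ∃ δ ∈ Δ, (g : W →ₗ[ℂ] W) = complexReflection B ε l δ})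
    (htrans : ∀ δ ∈ Δ, ∀ δ' ∈ Δ, ∃ g ∈ Γ, g δ = δ') (hinf : (Γ : Set (W ≃ₗ[ℂ] W)).Infinite)
    {g : W ≃ₗ[ℂ] W} (hg : LinearEquiv.det g = 1) : g ∈ glIdentityComponent Γ := by
  classical
  -- scalars
  have hε' : ε * ε = 1 := (sign_mul_self_and_conj hε).1
  obtain ⟨N, hNpos, hlN⟩ := hlN
  have hl0 : l ≠ 0 := by
    rintro rfl; rw [zero_pow hNpos.ne'] at hlN; exact zero_ne_one hlN
  have hll : l * l ≠ 1 := fun h => by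
    rcases mul_self_eq_one_iff.1 h with h | h
    · exact hl1 h
    · exact hl2 h
  -- basis and bridge
  set d := finrank ℂ W with hd
  let b : Basis (Fin d) ℂ W := Module.finBasis ℂ W
  haveI : Nontrivial (Fin d) := Fin.nontrivial_iff_two_le.2 hW
  obtain ⟨Ψ, hΨ⟩ := exists_mulEquiv_coe_eq_toMatrix b
  rw [mem_glIdentityComponent_iff]
  intro Γ' hΓ'le hfi
  rw [mem_glZariskiClosure_iff_mem_zariskiClosure b Ψ hΨ Γ' g]
  set Γm : Subgroup (GL (Fin d) ℂ) := Γ.map Ψ.toMonoidHom with hΓm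
  set Γm' : Subgroup (GL (Fin d) ℂ) := Γ'.map Ψ.toMonoidHom with hΓm'
  set H' := zariskiClosure Γm' with hH'
  have hH'alg : IsAlgebraicSubgroup H' := isAlgebraicSubgroup_zariskiClosure Γm'
  -- `Lie(H') = Lie(Γm)`
  have hfi' : (Γm'.subgroupOf Γm).FiniteIndex := by
    refine ⟨?_⟩
    change Γm'.relIndex Γm ≠ 0
    rw [hΓm', hΓm, Subgroup.relIndex_map_map_of_injective Γ' Γ Ψ.injective]
    exact hfi.index_ne_zero
  have hLie : lieAlgebraGL H' = lieAlgebraGL Γm := by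
    haveI := hfi'
    rw [hH', lieAlgebraGL_zariskiClosure, lieAlgebraGL_eq_of_finiteIndex (Subgroup.map_mono hΓ'le)]
  -- the Lie core: every traceless matrix lies in `Lie(Γm)`
  set L : Submodule ℂ (Module.End ℂ W) :=
    (lieAlgebraGL Γm).comap (LinearMap.toMatrix b b).toLinearMap with hL
  have hmemL : ∀ Y : Module.End ℂ W, Y ∈ L ↔ LinearMap.toMatrix b b Y ∈ lieAlgebraGL Γm := fun Y =>
    Iff.rfl
  obtain ⟨hbr, hAd⟩ := comap_lieAlgebraGL_bracket_and_conj b Ψ hΨ Γ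
  have hdet : ∀ γ ∈ Γm, Matrix.det ((γ : GL (Fin d) ℂ) : Matrix (Fin d) (Fin d) ℂ) ^ N = 1 := by
    rintro _ ⟨γ, hγ, rfl⟩
    change Matrix.det ((Ψ γ : GL (Fin d) ℂ) : Matrix (Fin d) (Fin d) ℂ) ^ N = 1
    rw [hΨ, LinearMap.det_toMatrix, ← LinearEquiv.coe_det, ← Units.val_pow_eq_pow_val,
      det_pow_eq_one_of_mem B hε' hlN hΔ hΓ hγ, Units.val_one]
  have htr : ∀ Y ∈ L, LinearMap.trace ℂ W Y = 0 := by
    intro Y hY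
    rw [LinearMap.trace_eq_matrix_trace ℂ b]
    exact trace_eq_zero_of_mem_lieAlgebraGL_of_det_pow_eq_one hNpos.ne' hdet ((hmemL Y).1 hY)
  have hL0 : L ≠ ⊥ := by
    have hΓminf : (Γm : Set (GL (Fin d) ℂ)).Infinite := by
      rw [hΓm, Subgroup.coe_map]
      exact hinf.image Ψ.injective.injOn
    obtain ⟨A, hA, hA0⟩ := Submodule.exists_mem_ne_zero_of_ne_bot (lieAlgebraGL_ne_bot_of_infinite hΓminf)
    intro hbot
    have hYL : Matrix.toLin b b A ∈ L := by
      rw [hmemL, LinearMap.toMatrix_toLin]; exact hA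
    rw [hbot, Submodule.mem_bot] at hYL
    exact hA0 ((Matrix.toLin b b).map_eq_zero_iff.1 hYL)
  have hcore : ∀ A : Matrix (Fin d) (Fin d) ℂ, A.trace = 0 → A ∈ lieAlgebraGL Γm := by
    intro A hA
    have h := mem_of_trace_eq_zero hBn hε' hl0 hl1 hll hΔ hspan hΓ htrans hL0 htr hbr hAd
      (Y := Matrix.toLin b b A) (by rw [LinearMap.trace_eq_matrix_trace ℂ b, LinearMap.toMatrix_toLin, hA])
    rwa [hmemL, LinearMap.toMatrix_toLin] at h
  -- transvections lie in `H'`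
  have htv : ∀ (i j : Fin d) (hij : i ≠ j) (a : ℂ),
      (Matrix.SpecialLinearGroup.transvection hij a : GL (Fin d) ℂ) ∈ H' := by
    intro i j hij a
    have hnil : IsNilpotent (Matrix.single i j a) :=
      ⟨2, by rw [pow_two]; exact Matrix.single_mul_single_of_ne a i j i (Ne.symm hij) a⟩
    have hA : Matrix.single i j a ∈ lieAlgebraGL H' := by
      rw [hLie]; exact hcore _ (Matrix.trace_single_eq_of_ne i j a hij)
    have hmem := expHom_mem_of_mem_lieAlgebraGL hH'alg hA hnil (Multiplicative.ofAdd (1 : ℂ))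
    have heq : expHom (Matrix.single i j a) hnil (Multiplicative.ofAdd (1 : ℂ)) =
        (Matrix.SpecialLinearGroup.transvection hij a : GL (Fin d) ℂ) :=
      Units.ext (by rw [coe_expHom_single hij a hnil]; rfl)
    rwa [heq] at hmem
  -- hence `SL ⊆ H'`
  have hSL : ∀ M : Matrix.SpecialLinearGroup (Fin d) ℂ, (M : GL (Fin d) ℂ) ∈ H' := fun M =>
    Literature.LinearAlgebra.Matrix.SLn.transvection_induction (fun M => (M : GL (Fin d) ℂ) ∈ H') htv
      (fun A B hA hB => by rw [map_mul]; exact H'.mul_mem hA hB) M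
  -- and `Ψ g ∈ SL`
  have hdetg : Matrix.det ((Ψ g : GL (Fin d) ℂ) : Matrix (Fin d) (Fin d) ℂ) = 1 := by
    rw [hΨ, LinearMap.det_toMatrix, ← LinearEquiv.coe_det, hg, Units.val_one]
  have heq : (Matrix.SpecialLinearGroup.toGL ⟨((Ψ g : GL (Fin d) ℂ) : Matrix (Fin d) (Fin d) ℂ), hdetg⟩) =
      Ψ g := Units.ext rfl
  have h := hSL ⟨((Ψ g : GL (Fin d) ℂ) : Matrix (Fin d) (Fin d) ℂ), hdetg⟩
  rwa [heq] at h

end Reflection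

end Literature.AlgebraicGeometry.HodgeTheory
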